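import Literature.NumberTheory.LocalFields.PadicFiniteSubextensions
import Literature.NumberTheory.AdelicBaseChange.CompletionBaseChange
import Literature.NumberTheory.GaloisRepresentations.PadicAlgebraOfLocalField
import Mathlib.NumberTheory.Padics.HeightOneSpectrum
import Mathlib.Analysis.Normed.Field.Approximation
import Mathlib.Algebra.Polynomial.Eval.Irreducible
import Mathlib.FieldTheory.PrimitiveElement
import Mathlib.Analysis.SpecialFunctions.Pow.Real
import HarnessLib

/-!
# Every `p`-adic field is the completion of a number field

Topic `NumberTheory/LocalFields`; namespace `Literature.NumberTheory.LocalFields`; a *proofs* file (theorems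
only, no definition, no named fact).  For a prime `p` and a finite extension `K` of `ℚ_p` — ANY field with
`[Algebra ℚ_[p] K] [FiniteDimensional ℚ_[p] K]`, no topology assumed — we PROVE:

* `exists_monic_rat_map_eq_minpoly_adjoin_eq` — for `y ∈ Q̄_p` (`PadicAlgCl p`) there are a monic `g ∈ ℚ[X]`
  and `z ∈ Q̄_p` with `g = minpoly_{ℚ_p} z` (after `ℚ → ℚ_p`) and `ℚ_p(y) = ℚ_p(z)`: approximate the minimal
  polynomial of `y` by a rational monic polynomial of the same degree (`ℚ` is dense in `ℚ_p`, Mathlib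
  `Polynomial.exists_monic_and_natDegree_eq_and_norm_map_algebraMap_coeff_sub_lt`), pick a root `z` of it
  close to `y` (continuity of roots, Mathlib `Polynomial.exists_aroots_norm_sub_lt_of_norm_coeff_sub_lt`),
  conclude `y ∈ ℚ_p(z)` by Krasner's lemma (tree `PadicFiniteSubextensions.mem_adjoin_of_norm_sub_lt`) and
  `ℚ_p(y) = ℚ_p(z)` by degrees [Neukirch, II §6 Exercise 2];
* `exists_monic_irreducible_algEquiv_adjoinRoot` — `K ≃ₐ[ℚ_p] ℚ_p[X]/(g)` for a monic `g ∈ ℚ[X]`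
  irreducible over `ℚ_p` (primitive element + the previous item);
* `exists_numberField_algEquiv_adicCompletion` — **there are a number field `F` and a place `𝔭 ∣ p` of `F`
  with `K ≃ₐ[ℚ_p] F_𝔭`**, `F_𝔭 = 𝔭.adicCompletion F` with its CANONICAL `ℚ_p`-algebra structure
  `LocalField.adicCompletionPadicAlgebra` (the unique continuous `ℚ_p → F_𝔭`, tree
  `GaloisRepresentations/PadicAlgebraOfLocalField`).  Proof [Neukirch, II (8.2)–(8.4)]: `F := ℚ[X]/(g)`;
  every `F_w`, `w ∣ p`, receives `K = ℚ_p[X]/(g)` (lift the root), so `[F_w : ℚ_p] ≥ deg g`, while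
  `∑_{w ∣ p} [F_w : ℚ_p] = ∑ e_w f_w = [F : ℚ] = deg g` (the tree's packet
  `AdelicBaseChange/CompletionBaseChange`: `Ideal.sum_ramification_inertia_extensions`,
  `adicCompletion.ramificationIdx_mul_inertiaDeg_eq_finrank` = Cassels–Fröhlich II §10 (10.2)); hence there is
  exactly one `w` and `K → F_w` is an isomorphism; its `ℚ_p`-linearity for the canonical structure is the
  uniqueness of continuous maps `ℚ_p → F_w` (`LocalField.eq_algebraMap_adicCompletionPadicAlgebra`).

USE.  A generic Mathlib-grade lemma with ZERO `HC_CM` currency (cell `hodgecm-mathlib`, background item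
(O-NC), director g3 2026-08-28): it turns any theorem proved for COMPLETIONS OF NUMBER FIELDS in the canonical
`ℚ_p`-currency into one for abstract finite extensions of `ℚ_p`.  Composed with
`QuadraticForms.hilbertSymbol_normCompat_adicCompletion_two` (p618033) it lets the cell `bsd-f1-sign2`
discharge its vendored named fact `QuadraticForms.HilbertSymbolNormCompatAtTwo` (file
`QuadraticForms/HilbertSymbolNormCompatAtTwoHolds.lean`, B-p04).

## References
* J. Neukirch, *Algebraic Number Theory*, Grundlehren 322 (1999), Ch. II §6 Exercise 2 (Krasner's lemma),
  Ch. II (8.2)–(8.4) (extensions of valuations ↔ irreducible factors over the completion;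
  `L ⊗_K K_v ≅ ∏_{w∣v} L_w`; `[L:K] = ∑ [L_w:K_v]`). [cite: NeukirchANT1999, Ch. II (8.2)-(8.4)]
* J. W. S. Cassels, A. Fröhlich (eds.), *Algebraic Number Theory* (1967), Ch. II §10 Theorem (10.2).
  [cite: CasselsFrohlichANT1967, Ch. II §10 Theorem (10.2)]
* E. Bombieri, W. Gubler, *Heights in Diophantine Geometry* (2006), 1.2.12 (completions of number fields are the
  `p`-adic fields). [cite: BombieriGubler2006, 1.2.12]
-/

noncomputable section

open Polynomial IntermediateField

namespace Literature.NumberTheory.LocalFields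

variable (p : ℕ) [Fact p.Prime]

/-! ## (A1) Krasner: a `p`-adic field is `ℚ_p[X]/(g)` with `g` rational -/

/-- **Krasner–continuity step.** For `y ∈ Q̄_p` there is a MONIC polynomial `g ∈ ℚ[X]` whose image
in `ℚ_p[X]` is the minimal polynomial of some `z ∈ Q̄_p` with `ℚ_p(y) = ℚ_p(z)`.
[cite: NeukirchANT1999, II §6 Ex. 1-2] -/
theorem exists_monic_rat_map_eq_minpoly_adjoin_eq (y : PadicAlgCl p) :
    ∃ (g : ℚ[X]) (z : PadicAlgCl p), g.Monic ∧ g.map (algebraMap ℚ ℚ_[p]) = minpoly ℚ_[p] z ∧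
      ℚ_[p]⟮y⟯ = ℚ_[p]⟮z⟯ := by
  have hyint : IsIntegral ℚ_[p] y := Algebra.IsIntegral.isIntegral y
  set f : ℚ_[p][X] := minpoly ℚ_[p] y with hf
  have hfm : f.Monic := minpoly.monic hyint
  set n : ℕ := f.natDegree with hn
  have hn0 : n ≠ 0 := (minpoly.natDegree_pos hyint).ne'
  -- a Krasner radius of `y`
  obtain ⟨ρ, hρ0, hρ⟩ := exists_krasner_radius p y
  -- the tolerance `ε` with `((n+1) ε)^{1/n} · max ‖y‖ 1 = ρ / 2`
  set M : ℝ := max ‖y‖ 1 with hM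
  have hM0 : 0 < M := lt_of_lt_of_le one_pos (le_max_right _ _)
  set ε : ℝ := (ρ / (2 * M)) ^ n / (n + 1) with hε
  have hn1 : (0 : ℝ) < n + 1 := by positivity
  have hε0 : 0 < ε := by positivity
  have hbound : ((f.natDegree + 1) * ε) ^ (f.natDegree : ℝ)⁻¹ * max ‖y‖ 1 = ρ / 2 := by
    rw [← hn, ← hM, hε, mul_div_cancel₀ _ hn1.ne', Real.pow_rpow_inv_natCast (by positivity) hn0]
    field_simp
  -- approximate `f` by a rational monic `g` of the same degree
  obtain ⟨g, hgm, hdeg, hcoeff⟩ :=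
    exists_monic_and_natDegree_eq_and_norm_map_algebraMap_coeff_sub_lt
      (K := ℚ) (by exact Padic.denseRange_ratCast p) hfm hε0
  set g' : ℚ_[p][X] := g.map (algebraMap ℚ ℚ_[p]) with hg'
  have hg'm : g'.Monic := hgm.map _
  have hdeg' : g'.natDegree = f.natDegree := by rw [hg', hgm.natDegree_map, hdeg]
  -- continuity of roots: a root `z` of `g'` within `ρ/2` of `y`
  obtain ⟨z, hz, hyz⟩ := exists_aroots_norm_sub_lt_of_norm_coeff_sub_lt (L := PadicAlgCl p) hε0
    (minpoly.aeval ℚ_[p] y) hfm hg'm hdeg' hcoeff (IsAlgClosed.splits _)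
  rw [hbound] at hyz
  have hyz' : ‖y - z‖ < ρ := hyz.trans (half_lt_self hρ0)
  -- Krasner: `y ∈ ℚ_p(z)`
  have hy_mem : y ∈ ℚ_[p]⟮z⟯ := mem_adjoin_of_norm_sub_lt p hρ hyz'
  have hle : ℚ_[p]⟮y⟯ ≤ ℚ_[p]⟮z⟯ := adjoin_simple_le_iff.2 hy_mem
  -- degrees: `minpoly z ∣ g'`, `deg g' = deg f = [ℚ_p(y) : ℚ_p] ≤ [ℚ_p(z) : ℚ_p] = deg (minpoly z)`
  have hzint : IsIntegral ℚ_[p] z := Algebra.IsIntegral.isIntegral z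
  have hgz : aeval z g' = 0 := by
    rw [mem_aroots] at hz
    exact hz.2
  have hdvd : minpoly ℚ_[p] z ∣ g' := minpoly.dvd ℚ_[p] z hgz
  haveI : FiniteDimensional ℚ_[p] ℚ_[p]⟮z⟯ := adjoin.finiteDimensional hzint
  have hfin_y : Module.finrank ℚ_[p] ℚ_[p]⟮y⟯ = n := by rw [adjoin.finrank hyint]
  have hfin_z : Module.finrank ℚ_[p] ℚ_[p]⟮z⟯ = (minpoly ℚ_[p] z).natDegree := adjoin.finrank hzint
  have hle_rank : n ≤ (minpoly ℚ_[p] z).natDegree := by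
    rw [← hfin_y, ← hfin_z]
    exact LinearMap.finrank_le_finrank_of_injective (f := (inclusion hle).toLinearMap)
      (inclusion_injective hle)
  have hmin : g' = minpoly ℚ_[p] z :=
    eq_of_monic_of_dvd_of_natDegree_le (minpoly.monic hzint) hg'm hdvd (by rw [hdeg']; exact hle_rank)
  refine ⟨g, z, hgm, hmin, ?_⟩
  -- equality of the two simple extensions by dimension
  refine eq_of_le_of_finrank_eq hle ?_
  rw [hfin_y, hfin_z, ← hmin, hdeg']

/-- **Every `p`-adic field is `ℚ_p[X]/(g)` for a rational `g`.** For a finite extension `K` of `ℚ_p`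
(any field with `[Algebra ℚ_[p] K] [FiniteDimensional ℚ_[p] K]`) there is a monic `g ∈ ℚ[X]`,
irreducible over `ℚ_p`, with `K ≃ₐ[ℚ_p] ℚ_p[X]/(g)` (primitive element + Krasner's lemma +
continuity of roots + density of `ℚ` in `ℚ_p`). [cite: NeukirchANT1999, II §6 Ex. 1-2] -/
theorem exists_monic_irreducible_algEquiv_adjoinRoot (K : Type*) [Field K] [Algebra ℚ_[p] K]
    [FiniteDimensional ℚ_[p] K] :
    ∃ g : ℚ[X], g.Monic ∧ Irreducible (g.map (algebraMap ℚ ℚ_[p])) ∧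
      Nonempty (K ≃ₐ[ℚ_[p]] AdjoinRoot (g.map (algebraMap ℚ ℚ_[p]))) := by
  -- embed `K` into `Q̄_p` and pick a primitive element
  let φ : K →ₐ[ℚ_[p]] PadicAlgCl p := IsAlgClosed.lift
  obtain ⟨α, hα⟩ := Field.exists_primitive_element ℚ_[p] K
  have hαint : IsIntegral ℚ_[p] α := Algebra.IsIntegral.isIntegral α
  set y : PadicAlgCl p := φ α with hy
  have hyint : IsIntegral ℚ_[p] y := Algebra.IsIntegral.isIntegral y
  have hminy : minpoly ℚ_[p] y = minpoly ℚ_[p] α := minpoly.algHom_eq φ φ.injective α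
  obtain ⟨g, z, hgm, hgz, hyz⟩ := exists_monic_rat_map_eq_minpoly_adjoin_eq p y
  have hzint : IsIntegral ℚ_[p] z := Algebra.IsIntegral.isIntegral z
  refine ⟨g, hgm, hgz ▸ minpoly.irreducible hzint, ⟨?_⟩⟩
  rw [hgz]
  -- `K ≃ ℚ_p⟮α⟯ ≃ AdjoinRoot (minpoly α) = AdjoinRoot (minpoly y) ≃ ℚ_p⟮y⟯ = ℚ_p⟮z⟯ ≃ AdjoinRoot (minpoly z)`
  have e₁ : K ≃ₐ[ℚ_[p]] AdjoinRoot (minpoly ℚ_[p] α) :=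
    (topEquiv.symm.trans (equivOfEq hα.symm)).trans (adjoinRootEquivAdjoin ℚ_[p] hαint).symm
  have e₂ : AdjoinRoot (minpoly ℚ_[p] α) ≃ₐ[ℚ_[p]] ℚ_[p]⟮y⟯ :=
    (AdjoinRoot.algEquivOfEq ℚ_[p] _ _ hminy.symm).trans (adjoinRootEquivAdjoin ℚ_[p] hyint)
  have e₃ : ℚ_[p]⟮y⟯ ≃ₐ[ℚ_[p]] AdjoinRoot (minpoly ℚ_[p] z) :=
    (equivOfEq hyz).trans (adjoinRootEquivAdjoin ℚ_[p] hzint).symm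
  exact (e₁.trans e₂).trans e₃

/-! ## (A2) The completion: `K ≃ₐ[ℚ_p] F_𝔭` -/

section Completion

open NumberField IsDedekindDomain IsDedekindDomain.HeightOneSpectrum
open Literature.NumberTheory.GaloisRepresentations (LocalField.adicCompletionPadicAlgebra
  LocalField.eq_algebraMap_adicCompletionPadicAlgebra)

/-- An irreducible monic `g ∈ ℚ[X]` has a root in some number field `F` of degree `deg g`
(namely `F = ℚ[X]/(g)`; stated for an abstract `F` so that the only `ℚ`-algebra structure in
play downstream is the canonical one of a characteristic-zero field). [folklore] -/
private theorem exists_numberField_aeval_eq_zero {g : ℚ[X]} (hg : Irreducible g) (hgm : g.Monic) :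
    ∃ (F : Type) (_ : Field F) (_ : NumberField F) (x : F),
      aeval x g = 0 ∧ Module.finrank ℚ F = g.natDegree := by
  haveI := Fact.mk hg
  have hg0 : g ≠ 0 := hgm.ne_zero
  haveI : CharZero (AdjoinRoot g) :=
    charZero_of_injective_algebraMap (algebraMap ℚ (AdjoinRoot g)).injective
  have hfin : FiniteDimensional ℚ (AdjoinRoot g) := (AdjoinRoot.powerBasis hg0).finite
  have hrank : Module.finrank ℚ (AdjoinRoot g) = g.natDegree := by
    rw [(AdjoinRoot.powerBasis hg0).finrank, AdjoinRoot.powerBasis_dim]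
  have hroot : aeval (AdjoinRoot.root g) g = 0 := AdjoinRoot.aeval_eq g ▸ AdjoinRoot.mk_self
  -- the `ℚ`-algebra structure of `AdjoinRoot g` and the canonical one of a char-0 field agree
  -- (`Subsingleton (Algebra ℚ _)`, used silently by `convert`)
  haveI : NumberField (AdjoinRoot g) := @NumberField.mk _ _ inferInstance (by convert hfin)
  refine ⟨AdjoinRoot g, inferInstance, inferInstance, AdjoinRoot.root g, ?_, ?_⟩
  · convert hroot
  · convert hrank

/-- The place `v_p = primesEquiv⁻¹ p` of `ℚ` contains `p` (Mathlib `Rat.HeightOneSpectrum.natGenerator_dvd_iff`;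
private twin of the helper in `QuadraticForms/HilbertSymbolNormCompatAtTwoCompletion`). [folklore] -/
private theorem natCast_mem_primesEquiv_symm_asIdeal :
    ((p : ℕ) : 𝓞 ℚ) ∈ ((Rat.HeightOneSpectrum.primesEquiv (R := 𝓞 ℚ)).symm ⟨p, Fact.out⟩).asIdeal := by
  set v := (Rat.HeightOneSpectrum.primesEquiv (R := 𝓞 ℚ)).symm ⟨p, Fact.out⟩ with hv
  have h := Ideal.symm_apply_mem_of_equiv_iff.2
    ((Rat.HeightOneSpectrum.natGenerator_dvd_iff v).1 (dvd_refl _))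
  have hgen : Rat.HeightOneSpectrum.natGenerator v = p :=
    congrArg Subtype.val ((Rat.HeightOneSpectrum.primesEquiv (R := 𝓞 ℚ)).apply_symm_apply ⟨p, Fact.out⟩)
  rwa [map_natCast, hgen] at h

variable {p} in
/-- Place bookkeeping: a place `w` of a number field above the place `v_p` of `ℚ` contains `p`.
[folklore] -/
private theorem natCast_mem_of_extension {F : Type} [Field F] [NumberField F]
    (w : ((Rat.HeightOneSpectrum.primesEquiv (R := 𝓞 ℚ)).symm ⟨p, Fact.out⟩).Extension (𝓞 F)) :
    ((p : ℕ) : 𝓞 F) ∈ w.1.asIdeal := by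
  have h : ((p : ℕ) : 𝓞 ℚ) ∈ (w.1.under (𝓞 ℚ)).asIdeal := by
    rw [w.2]; exact natCast_mem_primesEquiv_symm_asIdeal p
  change ((p : ℕ) : 𝓞 ℚ) ∈ Ideal.comap (algebraMap (𝓞 ℚ) (𝓞 F)) w.1.asIdeal at h
  rwa [Ideal.mem_comap, map_natCast] at h

/-- **Every `p`-adic field is a completion of a number field.** For a finite extension `K` of `ℚ_p`
(any field with `[Algebra ℚ_[p] K] [FiniteDimensional ℚ_[p] K]`) there are a number field `F` and a
place `𝔭 ∣ p` of `F` with `K ≃ₐ[ℚ_p] F_𝔭`, where `F_𝔭 = 𝔭.adicCompletion F` carries its canonical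
`ℚ_p`-algebra structure `LocalField.adicCompletionPadicAlgebra` (the unique continuous `ℚ_p → F_𝔭`).
Proof: `K ≅ ℚ_p[X]/(g)` with `g ∈ ℚ[X]` (Krasner, `exists_monic_irreducible_algEquiv_adjoinRoot`),
`F := ℚ[X]/(g)`; every `F_w` (`w ∣ p`) receives `K` (lift the root), so `[F_w : ℚ_p] ≥ deg g`, while
`∑_{w ∣ p} [F_w : ℚ_p] = [F : ℚ] = deg g` (Cassels–Fröhlich II §10 (10.2), the tree's packet
`Ideal.sum_ramification_inertia_extensions` + `ramificationIdx_mul_inertiaDeg_eq_finrank`); hence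
`K → F_w` is an isomorphism. [cite: NeukirchANT1999, II §6 Ex. 1-2] [cite: CasselsFrohlichANT1967, Ch. II §10 Theorem (10.2)] -/
theorem exists_numberField_algEquiv_adicCompletion (K : Type) [Field K] [Algebra ℚ_[p] K]
    [FiniteDimensional ℚ_[p] K] :
    ∃ (F : Type) (_ : Field F) (_ : NumberField F) (𝔭 : HeightOneSpectrum (𝓞 F))
      (h𝔭 : ((p : ℕ) : 𝓞 F) ∈ 𝔭.asIdeal),
      Nonempty (letI := LocalField.adicCompletionPadicAlgebra 𝔭 p h𝔭; K ≃ₐ[ℚ_[p]] 𝔭.adicCompletion F) := by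
  classical
  obtain ⟨g, hgm, hgirr, ⟨e₀⟩⟩ := exists_monic_irreducible_algEquiv_adjoinRoot p K
  set gp : ℚ_[p][X] := g.map (algebraMap ℚ ℚ_[p]) with hgp
  have hg : Irreducible g :=
    Monic.irreducible_of_irreducible_map (φ := algebraMap ℚ ℚ_[p]) g hgm (by rw [← hgp]; exact hgirr)
  obtain ⟨F, _, _, x, hx, hFdeg⟩ := exists_numberField_aeval_eq_zero hg hgm
  have hgp0 : gp ≠ 0 := (hgm.map _).ne_zero
  -- `n := [K : ℚ_p] = deg g = [F : ℚ]`
  have hn : Module.finrank ℚ_[p] K = g.natDegree := by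
    rw [e₀.toLinearEquiv.finrank_eq, (AdjoinRoot.powerBasis hgp0).finrank, AdjoinRoot.powerBasis_dim,
      hgp, hgm.natDegree_map]
  have hn0 : 0 < Module.finrank ℚ_[p] K := Module.finrank_pos
  -- the place `v ∣ p` of `ℚ` and `ℚ_p ≃ ℚ_v`
  set v : HeightOneSpectrum (𝓞 ℚ) := (Rat.HeightOneSpectrum.primesEquiv (R := 𝓞 ℚ)).symm ⟨p, Fact.out⟩
    with hv
  let e : ℚ_[p] ≃A[ℚ] v.adicCompletion ℚ := Padic.adicCompletionEquiv (𝓞 ℚ) ⟨p, Fact.out⟩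
  letI := Extension.fintype (𝓞 ℚ) ℚ F (𝓞 F) v
  have hw : ∀ w : v.Extension (𝓞 F), ((p : ℕ) : 𝓞 F) ∈ w.1.asIdeal := natCast_mem_of_extension
  -- for each `w ∣ v`: the ring map `ψ_w : K → F_w` through `ℚ_p[X]/(g)`
  have key : ∀ w : v.Extension (𝓞 F), ∃ ψ : K →+* w.1.adicCompletion F,
      (∀ r : ℚ_[p], ψ (algebraMap ℚ_[p] K r) =
        algebraMap (v.adicCompletion ℚ) (w.1.adicCompletion F) (e r)) := by
    intro w
    let i : ℚ_[p] →+* w.1.adicCompletion F :=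
      (algebraMap (v.adicCompletion ℚ) (w.1.adicCompletion F)).comp e.toRingEquiv.toRingHom
    have hi : i.comp (algebraMap ℚ ℚ_[p]) =
        (algebraMap F (w.1.adicCompletion F)).comp (algebraMap ℚ F) := Subsingleton.elim _ _
    have heval : gp.eval₂ i (algebraMap F (w.1.adicCompletion F) x) = 0 := by
      rw [hgp, eval₂_map, hi, ← hom_eval₂, ← aeval_def, hx, map_zero]
    refine ⟨(AdjoinRoot.lift i _ heval).comp e₀.toRingEquiv.toRingHom, fun r => ?_⟩
    change AdjoinRoot.lift i _ heval (e₀ (algebraMap ℚ_[p] K r)) = _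
    rw [e₀.commutes, AdjoinRoot.algebraMap_eq, AdjoinRoot.lift_of]
    rfl
  choose ψ hψ using key
  -- rank inequality `[K : ℚ_p] ≤ [F_w : ℚ_v]` for every `w`
  have hle : ∀ w : v.Extension (𝓞 F),
      Module.finrank ℚ_[p] K ≤ Module.finrank (v.adicCompletion ℚ) (w.1.adicCompletion F) := by
    intro w
    have hr : Module.rank ℚ_[p] K ≤ Module.rank (v.adicCompletion ℚ) (w.1.adicCompletion F) := by
      refine Algebra.rank_le_of_injective_injective e.symm.toRingEquiv.toRingHom (ψ w)
        e.symm.injective (ψ w).injective (RingHom.ext fun s => ?_)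
      simp only [RingEquiv.toRingHom_eq_coe, RingHom.coe_comp, RingHom.coe_coe, Function.comp_apply, hψ]
      exact congrArg _ (e.apply_symm_apply s)
    exact Cardinal.toNat_le_toNat hr (Module.rank_lt_aleph0 _ _)
  -- `∑_w [F_w : ℚ_v] = [F : ℚ] = deg g`
  have hsum : ∑ w : v.Extension (𝓞 F), Module.finrank (v.adicCompletion ℚ) (w.1.adicCompletion F) =
      g.natDegree := by
    rw [← hFdeg, ← Ideal.sum_ramification_inertia_extensions (𝓞 ℚ) ℚ F (𝓞 F) v]
    exact Finset.sum_congr rfl fun w _ =>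
      (adicCompletion.ramificationIdx_mul_inertiaDeg_eq_finrank ℚ F w).symm
  -- a place `w₀` above `p` exists, and `[F_{w₀} : ℚ_v] = [K : ℚ_p]`
  have hne : Nonempty (v.Extension (𝓞 F)) := by
    by_contra h
    rw [not_nonempty_iff] at h
    rw [Finset.univ_eq_empty, Finset.sum_empty] at hsum
    omega
  obtain ⟨w₀⟩ := hne
  have hw₀ : Module.finrank (v.adicCompletion ℚ) (w₀.1.adicCompletion F) = Module.finrank ℚ_[p] K := by
    refine le_antisymm ?_ (hle w₀)
    rw [hn, ← hsum]
    exact Finset.single_le_sum (f := fun w : v.Extension (𝓞 F) =>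
      Module.finrank (v.adicCompletion ℚ) (w.1.adicCompletion F)) (fun w _ => Nat.zero_le _)
      (Finset.mem_univ w₀)
  -- `ψ_{w₀}` is surjective: its range is a `ℚ_v`-subalgebra of full dimension
  let Sw : Subalgebra (v.adicCompletion ℚ) (w₀.1.adicCompletion F) :=
    { toSubsemiring := (ψ w₀).rangeS
      algebraMap_mem' := fun s => ⟨algebraMap ℚ_[p] K (e.symm s), by simp [hψ]⟩ }
  have hsurjS : Function.Surjective ((ψ w₀).rangeSRestrict) := (ψ w₀).rangeSRestrict_surjective
  have hinjS : Function.Injective ((ψ w₀).rangeSRestrict) := fun a b h =>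
    (ψ w₀).injective (congrArg Subtype.val h)
  let eK : K ≃+* Sw := RingEquiv.ofBijective ((ψ w₀).rangeSRestrict) ⟨hinjS, hsurjS⟩
  have hrankS : Module.rank ℚ_[p] K = Module.rank (v.adicCompletion ℚ) Sw := by
    refine Algebra.rank_eq_of_equiv_equiv e.toRingEquiv eK (RingHom.ext fun r => Subtype.ext ?_)
    simp [eK, hψ]
  have hSw : Sw = ⊤ := by
    rw [← Algebra.toSubmodule_eq_top]
    apply Submodule.eq_top_of_finrank_eq
    rw [Subalgebra.finrank_toSubmodule, hw₀]
    change Cardinal.toNat _ = Cardinal.toNat _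
    rw [hrankS]
  have hsurj : Function.Surjective (ψ w₀) := fun y => by
    have hy : y ∈ Sw := hSw ▸ Algebra.mem_top
    exact hy
  -- the `ℚ_p`-structure on `F_{w₀}` through `e` IS the canonical one (uniqueness of continuous maps)
  letI : Algebra ℚ_[p] (w₀.1.adicCompletion F) := LocalField.adicCompletionPadicAlgebra w₀.1 p (hw w₀)
  have hcont : Continuous
      ((algebraMap (v.adicCompletion ℚ) (w₀.1.adicCompletion F)).comp e.toRingEquiv.toRingHom) :=
    (w₀.adicCompletionSemialgHom_continuous ℚ F).comp e.continuous
  have hcomp := LocalField.eq_algebraMap_adicCompletionPadicAlgebra w₀.1 p (hw w₀) _ hcont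
  let ψa : K →ₐ[ℚ_[p]] w₀.1.adicCompletion F :=
    { toRingHom := ψ w₀
      commutes' := fun r => by
        change (ψ w₀) (algebraMap ℚ_[p] K r) = (algebraMap ℚ_[p] (w₀.1.adicCompletion F)) r
        rw [← hcomp, hψ w₀ r]
        rfl }
  exact ⟨F, inferInstance, inferInstance, w₀.1, hw w₀,
    ⟨AlgEquiv.ofBijective ψa ⟨(ψ w₀).injective, hsurj⟩⟩⟩

end Completion

end Literature.NumberTheory.LocalFields

end
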